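import Literature.AnabelianGeometry.EtaleTheta.Thm56SubdagStatementsGalois
import Literature.AnabelianGeometry.EtaleTheta.Discharge.Sec5BiThetaIso
import Literature.AnabelianGeometry.EtaleTheta.Discharge.Sec5Prop55EtaTautologicalOfBiTheta
import HarnessLib

/-!
# [EtTh] Lemma 5.9 (v) REDUCED and P55-L02 from the bi-theta isomorphism — the two generic `P`-binding strays of `Sec5BiThetaIso` /
# `Sec5Prop55EtaTautologicalOfBiTheta` ON THE v2 SUBQUOTIENT RECORD `ThetaSubquotientProjGalois` — PROOF-ONLY, proofs verbatim

S. Mochizuki, *The étale theta function and its Frobenioid-theoretic manifestations*, Publ. RIMS **45** (2009)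
[cite: MochizukiEtTh2009, Lem 5.9 (v) p.332 (PDF p.106); Prop 5.5 proof p.327 (PDF p.101); §5 p.327 (PDF p.101) «these subquotients
determine subquotients `Aut_D(D) ↠ Aut^Θ_D(D)`»].
abc-iut cell, layer L2, seat abc-iut-w6-d020 (gen 7), row «(w4-S) V1→V2 PORT — deep EndKnit*/AllLeavesV3*/KummerComparisonInputsLevel*
heads» (abc-iut-L2-lead gen 7 R957), layer S6 = the two remaining GENERIC `P`-binding leaves of the (w4-S) census that no carrier file imports.

WHY.  abc-iut-L2-t11's `cycRigidityCoincide_of` (`Sec5BiThetaIso`: Lemma 5.9 (v) REDUCED — `CycRigidityCoincide ρ219 ρ hB` as soon as `ρ219` is read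
off from the same Kummer class on the part of `H_{B_N}` over `(l·Δ_Θ)_{B_N}` and that part covers) and abc-iut-w5-d123's
`exists_eta_etaTautological_of_biTheta` (`Sec5Prop55EtaTautologicalOfBiTheta`: P55-L02 at ANY §5 datum carrying the bi-theta isomorphism) bind
abc-iut-L2-t4's v1 record `(P : ThetaSubquotientProj 𝔉)` (surjective at EVERY base object; EMPTY at the root model for `l` odd, p456572 /
p476337).  abc-iut-w6-d079's v2 record `ThetaSubquotientProjGalois 𝔉 Gal` (p481123) is INHABITED at every `ofSetting` carrier (p481568) and at
every level stub (p486065); `ThetaSubquotientProjGalois.IsKummerDetermined` (p481123) and `Thm56Sub.EtaTautologicalGal` (p484491) are the SAME formulas.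

THIS FILE re-keys both on the v2 record — binder `{Gal : D → Prop} (P : ThetaSubquotientProjGalois 𝔉 Gal)`, statements otherwise and proofs
VERBATIM (no `proj_surjective`), names = originals + `_galois`; the `P`-free producer `exists_eta_descent_of_biTheta` BY NAME.  0 `def`s; no
v1 file is edited; the v1 heads are the `P.toGalois Gal` instances (`Iff.rfl` bridges `isKummerDetermined_toGalois_iff`,
`etaTautologicalGal_toGalois_iff`).

HONEST FRAMING: a typing repair of the cell's OWN record (weaker quantifier on `P`, as print uses it); kernel-checked implications between typed
statements over an ABSTRACT §5 datum `𝔉`; nothing of [EtTh] (refereed) is asserted; typed ≠ discharged; nothing here bears on [IUTchIII]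
Cor. 3.12 — no side taken; nothing here asserts abc proved or refuted.
-/

namespace Literature.AnabelianGeometry.EtaleTheta

open CategoryTheory
open FrobenioidCyclotomicRigidity

universe w v v' u u'

namespace ThetaFrobenioid

variable {C : Type u} [Category.{v} C] {D : Type u'} [Category.{v'} D]
  (𝔉 : ThetaFrobenioid.{w} C D) {Gal : D → Prop}

/-! ### (1) Lemma 5.9 (v) REDUCED (abc-iut-L2-t11), v2 record -/

section Coincide

/-- (v2 record `ThetaSubquotientProjGalois`; the v1 theorem `cycRigidityCoincide_of` VERBATIM — binder type + twin names only.) **[EtTh] Lemma 5.9 (v) REDUCED**: "In the situation of (iv), the cyclotomic rigidity isomorphism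
arising from the theory of §2 [cf. Corollary 2.19, (i)] coincides with the Frobenioid-theoretic
isomorphism of Proposition 5.5 [where we take '`S`' to be `B_N`]" (p.106 (PRIMS p.332)) — abc-iut-L2-t4's
`CycRigidityCoincide ρ219 ρ hB` — holds as soon as the §2 isomorphism transported to `B_N` (`ρ219`,
their parameter; abc-iut-L2-t2's Cor. 2.19 (i)) is read off from the same Kummer class on the part of
`H_{B_N}` over `(l·Δ_Θ)_{B_N}` (`h219`, in print's orientation `s^⊓-gp_N · (s^⊔-gp_N)⁻¹` of
Prop. 4.3 (iii), matching abc-iut-L2-t4's `IsKummerDetermined` v3: via the isomorphism of (iv) the two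
theta sections differ by the class `η̲̈^Θ`, from which BOTH isomorphisms are constructed) and that part
covers `(l·Δ_Θ)_{B_N} ⊗ ℤ/Nℤ`.  [cite: MochizukiEtTh2009, Lem 5.9 (v) p.106 (PRIMS p.332)] -/
theorem cycRigidityCoincide_of_galois (P : ThetaSubquotientProjGalois 𝔉 Gal) (hB : 𝔉.IsThetaSaturated 𝔉.BN)
    (hcov : ∀ x : 𝔉.lDeltaModN 𝔉.BN, ∃ (h : 𝔉.HB)
      (hh : (h : Aut (𝔉.base.obj 𝔉.BN)) ∈ P.pre (𝔉.base.obj 𝔉.BN)),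
      (QuotientGroup.mk (P.proj _ ⟨h, hh⟩) : 𝔉.lDeltaModN 𝔉.BN) = x)
    (ρ219 : 𝔉.lDeltaModN 𝔉.BN ≃* 𝔉.muTorsion 𝔉.BN 𝔉.N) (ρ : RigidityFamily 𝔉)
    (hρ : ThetaSubquotientProjGalois.IsKummerDetermined (𝔉 := 𝔉) P ρ hB)
    (h219 : ∀ (h : 𝔉.HB) (hh : (h : Aut (𝔉.base.obj 𝔉.BN)) ∈ P.pre (𝔉.base.obj 𝔉.BN)),
      (ρ219 (QuotientGroup.mk (P.proj _ ⟨h, hh⟩)) : Aut 𝔉.BN) =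
        𝔉.sgpCap (h : Aut (𝔉.base.obj 𝔉.BN)) * (𝔉.sgpCup h)⁻¹) :
    𝔉.CycRigidityCoincide ρ219 ρ hB := by
  apply MulEquiv.ext
  intro x
  obtain ⟨h, hh, rfl⟩ := hcov x
  apply Subtype.ext
  rw [hρ h hh, h219 h hh]

end Coincide

/-! ### (2) P55-L02 from the bi-theta isomorphism (abc-iut-w5-d123), v2 record -/

section EtaOfBiTheta

variable (h1 : 𝔉.SectionsFactor) (h3 : 𝔉.OuterActionLZ) (hsec : 𝔉.SgpCapSection) (hcs : 𝔉.SgpCupSection)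
  (h8 : 𝔉.ConstantsEqNormalizer) (DK : Set (TopOut 𝔉.EPiN))

/-- (v2 record `ThetaSubquotientProjGalois`; the v1 theorem `exists_eta_etaTautological_of_biTheta` VERBATIM — binder type + twin names only.) **P55-L02 at ANY §5 datum with the bi-theta isomorphism, from the row-2 laws**: with `e := ψ⁻¹` and (hlift), (hP)
(GAP G-w5d123-2), there is `η_H : H_{B_N} → (l·Δ_Θ)_{B_N} ⊗ ℤ/Nℤ` descending the isomorphism's cocycle `η` and
TAUTOLOGICAL on the part of `H_{B_N}` over `(l·Δ_Θ)_{B_N}` (`Thm56Sub.EtaTautologicalGal 𝔉 P η_H`): for `h = ρ k`,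
`k ∈ Π^tp_Ÿ̲ ∩ ι⁻¹θ⁻¹(l·Δ_Θ)`: `η_H h = ψ⁻¹(η(ι k)) = ψ⁻¹(θ-mod(ι k)) = [proj h]` (w5-d123's argument).  No `hdies` binder.
[cite: MochizukiEtTh2009, Prop 5.5 proof p.327 (PDF p.101)] -/
theorem exists_eta_etaTautological_of_biTheta_galois {l : ℕ} (R : RigidData.{v} 𝔉.N l) (ι : 𝔉.PiX ≃ₜ* R.PiX)
    {η : R.PiYdd → R.mu} (hη : η ∈ R.thetaCocycles)
    (i : (𝔉.frdBiThetaEnv h1 h3 hsec hcs h8 DK).Iso (R.toThetaEnvData.modelBi hη))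
    (hi : ∀ x : 𝔉.EPiN, ((CycEnvelope.proj R.augY R.chi (i.e x) : R.PiY) : R.PiX) = ι (𝔉.toPiY x))
    (hYdd : 𝔉.PiYdd.map ι.toMonoidHom = R.PiYdd) (P : ThetaSubquotientProjGalois 𝔉 Gal) (ψ : 𝔉.lDeltaModN 𝔉.BN ≃* R.mu)
    (hlift : ∀ a ∈ 𝔉.HB, a ∈ P.pre (𝔉.base.obj 𝔉.BN) →
      ∃ k : 𝔉.PiYdd, ι (k : 𝔉.PiX) ∈ R.lDeltaTheta ∧ 𝔉.ρ (k : 𝔉.PiX) = a)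
    (hP : ∀ (k : 𝔉.PiYdd) (hk : ι (k : 𝔉.PiX) ∈ R.lDeltaTheta) (hm : 𝔉.ρ (k : 𝔉.PiX) ∈ P.pre (𝔉.base.obj 𝔉.BN)),
      (QuotientGroup.mk (P.proj _ ⟨𝔉.ρ (k : 𝔉.PiX), hm⟩) : 𝔉.lDeltaModN 𝔉.BN) =
        ψ.symm (R.thetaMod ⟨ι (k : 𝔉.PiX), hk⟩)) :
    ∃ ηH : 𝔉.HB → 𝔉.lDeltaModN 𝔉.BN,
      (∀ y : 𝔉.PiYdd, ηH (𝔉.rhoYdd y) = ψ.symm (η ⟨ι (y : 𝔉.PiX), 𝔉.iota_mem_PiYdd R.toThetaEnvData ι hYdd y⟩)) ∧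
      Thm56Sub.EtaTautologicalGal 𝔉 P ηH := by
  obtain ⟨ηH, hηH⟩ := 𝔉.exists_eta_descent_of_biTheta h1 h3 hsec hcs h8 DK R.toThetaEnvData ι hη i hi hYdd ψ.symm
  refine ⟨ηH, hηH, fun h hh => ?_⟩
  obtain ⟨k, hk, hρ⟩ := hlift _ h.2 hh
  have hkh : 𝔉.rhoYdd k = h := Subtype.ext hρ
  subst hkh
  rw [hηH k, R.cocycle_lDeltaTheta η hη ⟨ι (k : 𝔉.PiX), 𝔉.iota_mem_PiYdd R.toThetaEnvData ι hYdd k⟩ hk]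
  exact (hP k hk hh).symm

end EtaOfBiTheta

end ThetaFrobenioid

end Literature.AnabelianGeometry.EtaleTheta
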